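import Mathlib
import Literature.Computability.Complexity.CircuitClassesProofs
import Summits.PneNP.PneNP.Theorems.KarlinRubinMonotoneSufficesShiftHybrid
import Summits.PneNP.PneNP.Theorems.KarlinRubinMonotoneSufficesShiftCollision

/-!
# Crux `MonotoneSuffices` (stmt-PneNP-18026), line `Sketch` — scope of the SHIFT lever, part 3:
# recursive majority resists every shift

The coin: `RM[h, y]`, the depth-`h` RECURSIVE MAJORITY-OF-THREE of the `3^h` bits
`y : (Fin h → Fin 3) → Bool` (the tree's `recMaj` of `CircuitClassesProofs` with the leaf verdict
"read the coin"), a read-once monotone formula of size `O(3^h)` and an exact two-sided coin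
(`two_mul_card_recMaj_true`: exactly half of the cube accepts, by anti-self-duality).

* `card_gain_recMaj_mul_le` — **restricted influences are tiny**: on top of ANY upward restriction
  `y ↦ y ∨ 1_T`, forcing one more leaf gains at most `2^{3^h}/2^{h+1}` points of the cube
  (i.e. the restricted influence of every leaf is `≤ 2^{-h}`: a leaf is pivotal iff at each of its
  `h` ancestors the two sibling subtrees disagree, and an upward-restricted subtree is `1` with
  probability `≥ 1/2` — `two_mul_card_recMaj_upShift_ge` — so siblings disagree with probability
  `≤ 1/2`, independently over the levels);
* **`recMaj_shiftResistant`** (registered helper sub-goal) — hence, by parts 1–2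
  (`shift_hybrid`, `shift_collision`): every law on up-shifts `R` that enters `{RM = 1}` with
  probability `≥ 3/4` forces `≥ 2^h / 2` leaves on average and has collision number
  `∑ w i w j 2^{#(R_i ∩ R_j)} ≥ 2^{4^h/(4·3^h)}` — super-polynomial in the number of leaves
  `N' = 3^h` (`4^h/3^h = N'^{log₃ 4 - 1} = N'^{0.2618…}`).

So one negation of a recursive-majority coin is beyond every shift lever of the negation ladder
(evidence memo `session4-shift-levers.md`, §2): after `stub_shiftableLayer` the residue of rung 2 is
exactly the coins of small restricted influence, and no further shift rung exists.
-/

set_option linter.dupNamespace false -- `Summit.PneNP.PneNP.…`: summit = sub-problem name (D-0017 single-conjunct layout)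

namespace Summit.PneNP.PneNP.Theorems.MonotoneSuffices.ShiftNoGo

open Finset Literature.Computability.Complexity

/-! ### Majority of three -/

/-- `maj3` is monotone. [folklore] -/
theorem maj3_mono {a b c a' b' c' : Bool} (ha : a ≤ a') (hb : b ≤ b') (hc : c ≤ c') :
    maj3 a b c ≤ maj3 a' b' c' := by
  revert a b c a' b' c'
  decide

/-- `maj3` is anti-self-dual. [folklore] -/
theorem maj3_not (a b c : Bool) : maj3 (!a) (!b) (!c) = !maj3 a b c := by
  revert a b c
  decide

/-! ### The recursive majority of the leaves -/

/-- Depth `0`: the single leaf. [folklore] -/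
theorem recMaj_zero (y : (Fin 0 → Fin 3) → Bool) : (Literature.Computability.Complexity.recMaj (fun (_ : Unit → Bool) (ω : Unit → Bool) => ω ()) (0) (fun (_ : Unit) => false) (fun c (_ : Unit) => y c)) = y Fin.elim0 := rfl

/-- Depth `k + 1`: the majority of the three depth-`k` subtrees. [folklore] -/
theorem recMaj_succ (k : ℕ) (y : (Fin (k + 1) → Fin 3) → Bool) :
    (Literature.Computability.Complexity.recMaj (fun (_ : Unit → Bool) (ω : Unit → Bool) => ω ()) (k + 1) (fun (_ : Unit) => false) (fun c (_ : Unit) => y c)) = maj3 (Literature.Computability.Complexity.recMaj (fun (_ : Unit → Bool) (ω : Unit → Bool) => ω ()) (k) (fun (_ : Unit) => false) (fun c (_ : Unit) => (fun c => y (Fin.cons 0 c)) c)) (Literature.Computability.Complexity.recMaj (fun (_ : Unit → Bool) (ω : Unit → Bool) => ω ()) (k) (fun (_ : Unit) => false) (fun c (_ : Unit) => (fun c => y (Fin.cons 1 c)) c))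
      (Literature.Computability.Complexity.recMaj (fun (_ : Unit → Bool) (ω : Unit → Bool) => ω ()) (k) (fun (_ : Unit) => false) (fun c (_ : Unit) => (fun c => y (Fin.cons 2 c)) c)) := rfl

/-- The recursive majority is monotone in the leaves. [folklore] -/
theorem recMaj_mono : ∀ (k : ℕ) {y y' : (Fin k → Fin 3) → Bool}, y ≤ y' → (Literature.Computability.Complexity.recMaj (fun (_ : Unit → Bool) (ω : Unit → Bool) => ω ()) (k) (fun (_ : Unit) => false) (fun c (_ : Unit) => y c)) ≤ (Literature.Computability.Complexity.recMaj (fun (_ : Unit → Bool) (ω : Unit → Bool) => ω ()) (k) (fun (_ : Unit) => false) (fun c (_ : Unit) => y' c))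
  | 0, _, _, h => by rw [recMaj_zero, recMaj_zero]; exact h _
  | k + 1, _, _, h => by
    rw [recMaj_succ, recMaj_succ]
    exact maj3_mono (recMaj_mono k fun c => h _) (recMaj_mono k fun c => h _) (recMaj_mono k fun c => h _)

/-- The recursive majority is anti-self-dual: flipping every leaf flips the value. [folklore] -/
theorem recMaj_not : ∀ (k : ℕ) (y : (Fin k → Fin 3) → Bool), (Literature.Computability.Complexity.recMaj (fun (_ : Unit → Bool) (ω : Unit → Bool) => ω ()) (k) (fun (_ : Unit) => false) (fun c (_ : Unit) => (fun c => !y c) c)) = !(Literature.Computability.Complexity.recMaj (fun (_ : Unit → Bool) (ω : Unit → Bool) => ω ()) (k) (fun (_ : Unit) => false) (fun c (_ : Unit) => y c))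
  | 0, y => by rw [recMaj_zero, recMaj_zero]
  | k + 1, y => by
    rw [recMaj_succ, recMaj_succ, ← maj3_not]
    exact congrArg₃ maj3 (recMaj_not k _) (recMaj_not k _) (recMaj_not k _)
  where
  /-- helper: `maj3` respects equality in its three arguments -/
  congrArg₃ (f : Bool → Bool → Bool → Bool) {a a' b b' c c' : Bool} (h1 : a = a') (h2 : b = b')
      (h3 : c = c') : f a b c = f a' b' c' := by subst h1 h2 h3; rfl

/-- **An exact coin**: exactly half of the leaf vectors are accepted. [folklore] -/
theorem two_mul_card_recMaj_true (k : ℕ) :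
    2 * #((univ : Finset ((Fin k → Fin 3) → Bool)).filter fun y => (Literature.Computability.Complexity.recMaj (fun (_ : Unit → Bool) (ω : Unit → Bool) => ω ()) (k) (fun (_ : Unit) => false) (fun c (_ : Unit) => y c)) = true) = 2 ^ 3 ^ k := by
  classical
  -- flipping all leaves is an involution of the cube exchanging acceptance and rejection
  let flip : ((Fin k → Fin 3) → Bool) ≃ ((Fin k → Fin 3) → Bool) :=
    { toFun := fun y c => !y c
      invFun := fun y c => !y c
      left_inv := fun y => funext fun c => Bool.not_not (y c)
      right_inv := fun y => funext fun c => Bool.not_not (y c) }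
  have hflip : #((univ : Finset ((Fin k → Fin 3) → Bool)).filter fun y => (Literature.Computability.Complexity.recMaj (fun (_ : Unit → Bool) (ω : Unit → Bool) => ω ()) (k) (fun (_ : Unit) => false) (fun c (_ : Unit) => y c)) = true) =
      #((univ : Finset ((Fin k → Fin 3) → Bool)).filter fun y => (Literature.Computability.Complexity.recMaj (fun (_ : Unit → Bool) (ω : Unit → Bool) => ω ()) (k) (fun (_ : Unit) => false) (fun c (_ : Unit) => y c)) = false) := by
    refine card_equiv flip fun y => ?_
    simp only [mem_filter, mem_univ, true_and]
    have h : (Literature.Computability.Complexity.recMaj (fun (_ : Unit → Bool) (ω : Unit → Bool) => ω ()) (k) (fun (_ : Unit) => false) (fun c (_ : Unit) => (flip y) c)) = !(Literature.Computability.Complexity.recMaj (fun (_ : Unit → Bool) (ω : Unit → Bool) => ω ()) (k) (fun (_ : Unit) => false) (fun c (_ : Unit) => y c)) := recMaj_not k y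
    rw [h]
    cases (Literature.Computability.Complexity.recMaj (fun (_ : Unit → Bool) (ω : Unit → Bool) => ω ()) (k) (fun (_ : Unit) => false) (fun c (_ : Unit) => y c)) <;> simp
  have htot := card_filter_add_card_filter_not (s := (univ : Finset ((Fin k → Fin 3) → Bool)))
    (fun y => (Literature.Computability.Complexity.recMaj (fun (_ : Unit → Bool) (ω : Unit → Bool) => ω ()) (k) (fun (_ : Unit) => false) (fun c (_ : Unit) => y c)) = true)
  rw [card_univ, Fintype.card_fun, Fintype.card_bool, Fintype.card_fun, Fintype.card_fin,
    Fintype.card_fin] at htot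
  have hneg : #((univ : Finset ((Fin k → Fin 3) → Bool)).filter fun y => ¬ (Literature.Computability.Complexity.recMaj (fun (_ : Unit → Bool) (ω : Unit → Bool) => ω ()) (k) (fun (_ : Unit) => false) (fun c (_ : Unit) => y c)) = true) =
      #((univ : Finset ((Fin k → Fin 3) → Bool)).filter fun y => (Literature.Computability.Complexity.recMaj (fun (_ : Unit → Bool) (ω : Unit → Bool) => ω ()) (k) (fun (_ : Unit) => false) (fun c (_ : Unit) => y c)) = false) :=
    congrArg Finset.card (filter_congr fun y _ => by simp)
  omega

/-! ### Splitting along the first letter of the path -/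

/-- Inserting the leaf `i :: p` adds `p` to the shift set `T_i = {c : i :: c ∈ T}` seen from subtree
`i` … [folklore] -/
theorem filter_cons_insert_self (k : ℕ) (T : Finset (Fin (k + 1) → Fin 3)) (i : Fin 3)
    (p : Fin k → Fin 3) :
    ((univ : Finset (Fin k → Fin 3)).filter fun c =>
        (Fin.cons i c : Fin (k + 1) → Fin 3) ∈ insert (Fin.cons i p) T) =
      insert p ((univ : Finset (Fin k → Fin 3)).filter fun c => (Fin.cons i c : Fin (k + 1) → Fin 3) ∈ T) := by
  ext c
  simp [Fin.cons_inj]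

/-- … and leaves `T_j` unchanged for `j ≠ i`. [folklore] -/
theorem filter_cons_insert_ne (k : ℕ) (T : Finset (Fin (k + 1) → Fin 3)) {i j : Fin 3} (hij : j ≠ i)
    (p : Fin k → Fin 3) :
    ((univ : Finset (Fin k → Fin 3)).filter fun c =>
        (Fin.cons j c : Fin (k + 1) → Fin 3) ∈ insert (Fin.cons i p) T) =
      ((univ : Finset (Fin k → Fin 3)).filter fun c => (Fin.cons j c : Fin (k + 1) → Fin 3) ∈ T) := by
  ext c
  simp [Fin.cons_inj, hij]

/-- The shifted recursive majority at depth `k + 1` is the majority of the three shifted subtrees,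
subtree `j` being shifted by `T_j`. [folklore] -/
theorem recMaj_succ_upShift (k : ℕ) (y : (Fin (k + 1) → Fin 3) → Bool) (T : Finset (Fin (k + 1) → Fin 3)) :
    (Literature.Computability.Complexity.recMaj (fun (_ : Unit → Bool) (ω : Unit → Bool) => ω ()) (k + 1) (fun (_ : Unit) => false) (fun c (_ : Unit) => (y c || decide (c ∈ T)))) =
      maj3 (Literature.Computability.Complexity.recMaj (fun (_ : Unit → Bool) (ω : Unit → Bool) => ω ()) (k) (fun (_ : Unit) => false) (fun c (_ : Unit) => (y (Fin.cons 0 c) || decide (c ∈ ((univ : Finset (Fin k → Fin 3)).filter fun c => (Fin.cons 0 c : Fin (k + 1) → Fin 3) ∈ T))))) (Literature.Computability.Complexity.recMaj (fun (_ : Unit → Bool) (ω : Unit → Bool) => ω ()) (k) (fun (_ : Unit) => false) (fun c (_ : Unit) => (y (Fin.cons 1 c) || decide (c ∈ ((univ : Finset (Fin k → Fin 3)).filter fun c => (Fin.cons 1 c : Fin (k + 1) → Fin 3) ∈ T))))) (Literature.Computability.Complexity.recMaj (fun (_ : Unit → Bool) (ω : Unit → Bool) => ω ()) (k) (fun (_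 : Unit) => false) (fun c (_ : Unit) => (y (Fin.cons 2 c) || decide (c ∈ ((univ : Finset (Fin k → Fin 3)).filter fun c => (Fin.cons 2 c : Fin (k + 1) → Fin 3) ∈ T))))) := by
  have h : ∀ j : Fin 3, (fun c (_ : Unit) => (y (Fin.cons j c) || decide ((Fin.cons j c : Fin (k + 1) → Fin 3) ∈ T))) =
      fun c (_ : Unit) => (y (Fin.cons j c) || decide (c ∈ ((univ : Finset (Fin k → Fin 3)).filter fun c => (Fin.cons j c : Fin (k + 1) → Fin 3) ∈ T))) := by
    intro j; funext c; simp
  rw [← h 0, ← h 1, ← h 2]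
  rfl

/-- Counting leaf vectors of depth `k + 1` through their three subtree restrictions
(`splitCoins`). [folklore] -/
theorem card_filter_succ_eq (k : ℕ) (Φ : (Fin 3 → (Fin k → Fin 3) → Bool) → Prop) [DecidablePred Φ] :
    #((univ : Finset ((Fin (k + 1) → Fin 3) → Bool)).filter fun y => Φ fun j c => y (Fin.cons j c)) =
      #((univ : Finset (Fin 3 → (Fin k → Fin 3) → Bool)).filter fun θ => Φ θ) := by
  refine card_equiv (splitCoins k Bool) fun y => ?_
  simp only [mem_filter, mem_univ, true_and]
  rfl

/-! ### Arithmetic of majority-of-three -/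

/-- If `maj3 = 0` then two arguments are `0`, in one of three disjoint patterns. [folklore] -/
theorem maj3_false_cases (a b c : Bool) (h : maj3 a b c = false) :
    (a = false ∧ b = false) ∨ (a = false ∧ b = true ∧ c = false) ∨ (a = true ∧ b = false ∧ c = false) := by
  revert a b c
  decide

/-- If the majority of a triple flips from `0` to `1` when only coordinate `i` grows, then coordinate
`i` flipped and the two other coordinates disagree. [folklore] -/
theorem maj3_gain_general (i : Fin 3) (v : Fin 3 → Bool) (n : Bool)
    (hle : v i = true → n = true)
    (hn : maj3 (Function.update v i n 0) (Function.update v i n 1) (Function.update v i n 2) = true)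
    (ho : maj3 (v 0) (v 1) (v 2) = false) :
    (n = true ∧ v i = false) ∧ v (i.succAbove 0) ≠ v (i.succAbove 1) := by
  revert i v n
  decide

/-- `M³ ≥ 2 · (b₀b₁M + b₀a₁b₂ + a₀b₁b₂)` when `a_j + b_j = M` and `2 b_j ≤ M`: three independent bits,
each `0` with probability `≤ 1/2`, have majority `0` with probability `≤ 1/2`
(`M³ - 2(…) = ½ (u₀M(M-u₁) + u₀u₁(M-u₂) + M²(u₁+u₂))` with `u_j = M - 2b_j`). [folklore] -/
theorem two_mul_rej_le {M a0 a1 b0 b1 b2 : ℝ} (h0 : a0 + b0 = M) (h1 : a1 + b1 = M)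
    (hb0' : 0 ≤ b0) (hb1' : 0 ≤ b1) (hb2' : 0 ≤ b2) (hb0 : 2 * b0 ≤ M) (hb1 : 2 * b1 ≤ M) (hb2 : 2 * b2 ≤ M) :
    2 * (b0 * b1 * M + b0 * a1 * b2 + a0 * b1 * b2) ≤ M * M * M := by
  have ha0 : a0 = M - b0 := by linarith
  have ha1 : a1 = M - b1 := by linarith
  subst ha0 ha1
  have hu0 : 0 ≤ M - 2 * b0 := by linarith
  have hu1 : 0 ≤ M - 2 * b1 := by linarith
  have hu2 : 0 ≤ M - 2 * b2 := by linarith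
  have hM : 0 ≤ M := by linarith
  have hMu1 : 0 ≤ M - (M - 2 * b1) := by linarith
  have hMu2 : 0 ≤ M - (M - 2 * b2) := by linarith
  nlinarith [mul_nonneg (mul_nonneg hu0 hM) hMu1, mul_nonneg (mul_nonneg hu0 hu1) hMu2,
    mul_nonneg (mul_nonneg hM hM) hu1, mul_nonneg (mul_nonneg hM hM) hu2]

/-- `M² ≥ 2 · (a b' + b a')` (cross term) when `a + b = a' + b' = M`, `2b ≤ M`, `2b' ≤ M`: two
independent bits, each `0` with probability `≤ 1/2`, disagree with probability `≤ 1/2`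
(`M² - 2(ab' + ba') = (M - 2b)(M - 2b')`). [folklore] -/
theorem two_mul_cross_le {M a b a' b' : ℝ} (h : a + b = M) (h' : a' + b' = M) (hb : 2 * b ≤ M)
    (hb' : 2 * b' ≤ M) : 2 * (a * b' + b * a') ≤ M * M := by
  have ha : a = M - b := by linarith
  have ha' : a' = M - b' := by linarith
  subst ha ha'
  have hu : 0 ≤ M - 2 * b := by linarith
  have hu' : 0 ≤ M - 2 * b' := by linarith
  nlinarith [mul_nonneg hu hu']

/-! ### Boxes in the cube of subtree triples -/

/-- Membership in a box of triples. [folklore] -/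
theorem mem_pi3 {S : Type*} (X Y Z : Finset S) (θ : Fin 3 → S) :
    θ ∈ Fintype.piFinset ![X, Y, Z] ↔ θ 0 ∈ X ∧ θ 1 ∈ Y ∧ θ 2 ∈ Z := by
  simp [Fintype.mem_piFinset, Fin.forall_fin_succ]

/-- Cardinality of a box of triples. [folklore] -/
theorem card_pi3 {S : Type*} (X Y Z : Finset S) : #(Fintype.piFinset ![X, Y, Z]) = #X * #Y * #Z := by
  simp [Fintype.card_piFinset, Fin.prod_univ_three]

/-- Pairs that disagree about membership: `#X · (M - #Y) + (M - #X) · #Y`. [folklore] -/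
theorem card_disagree {S : Type*} [Fintype S] [DecidableEq S] (X Y : Finset S) :
    #((univ : Finset (Fin 2 → S)).filter fun ρ => (ρ 0 ∈ X) ≠ (ρ 1 ∈ Y)) =
      #X * (Fintype.card S - #Y) + (Fintype.card S - #X) * #Y := by
  have e : #((univ : Finset (Fin 2 → S)).filter fun ρ => (ρ 0 ∈ X) ≠ (ρ 1 ∈ Y)) =
      #((univ : Finset (S × S)).filter fun q => (q.1 ∈ X) ≠ (q.2 ∈ Y)) := by
    refine card_equiv (finTwoArrowEquiv S) fun ρ => ?_
    simp
  rw [e]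
  have hsplit : ((univ : Finset (S × S)).filter fun q => (q.1 ∈ X) ≠ (q.2 ∈ Y)) =
      X ×ˢ Yᶜ ∪ Xᶜ ×ˢ Y := by
    ext q
    simp only [mem_filter, mem_univ, true_and, mem_union, mem_product, mem_compl, ne_eq]
    tauto
  rw [hsplit, card_union_of_disjoint, card_product, card_product, card_compl, card_compl]
  rw [disjoint_left]
  rintro q h1 h2
  rw [mem_product, mem_compl] at h1 h2
  exact h2.1 h1.1

/-- The number of leaf vectors of depth `k`. [folklore] -/
theorem card_leaves (k : ℕ) : Fintype.card ((Fin k → Fin 3) → Bool) = 2 ^ 3 ^ k := by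
  rw [Fintype.card_fun, Fintype.card_bool, Fintype.card_fun, Fintype.card_fin, Fintype.card_fin]

/-- **recMaj_halfAccepts** (registered helper sub-goal of stmt-PneNP-18026, scope of the shift lever,
part 3a): the recursive majority of `3^k` uniform leaves is an exact coin (`two_mul_card_recMaj_true`).
[folklore] -/
theorem recMaj_halfAccepts :
    ∀ k : ℕ, 2 * #((Finset.univ : Finset ((Fin k → Fin 3) → Bool)).filter fun y => Literature.Computability.Complexity.recMaj (fun (_ : Unit → Bool) (ω : Unit → Bool) => ω ()) k (fun (_ : Unit) => false) (fun c (_ : Unit) => y c) = true) = 2 ^ 3 ^ k :=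
  fun k => two_mul_card_recMaj_true k

end Summit.PneNP.PneNP.Theorems.MonotoneSuffices.ShiftNoGo
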